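import Literature.NumberTheory.EllipticCurves.ZpExtensionEisensteinTwistResidualTorsionProofs
import Literature.NumberTheory.GaloisCohomology.Howard2004.ResidualTauEigenlinesProofs
import Literature.NumberTheory.EllipticCurves.HeegnerPointsKolyvaginConjugation
import Literature.NumberTheory.EllipticCurves.WeilPairingProofs
import HarnessLib

/-!
# The `G_ℚ`-structure `θ = τ_*` on `T̄_𝔮 = E[p]` (Howard's H.5(a) datum `ResidualTau`) for the specialised
# modules, and H.5(a) for it (one definition with body + theorems)

Topic `NumberTheory/EllipticCurves`. For Howard's specialised triple at the Eisenstein prime (level `k`: the module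
`E_K[p^k] ⊗ A_{m,k}(ψ)` with residual presentation `T̄ = E_K[p]`, `A_{m,k}` acting through the residue character —
`EisensteinCoeff.residueModule`, files `ZpExtensionScalarTwistResidualQuotient` / `…ResidualTorsionProofs`), Howard's
hypothesis H.5(a) «the action of `G_K` on `T̄` extends to an action of `G_ℚ` and the action of `τ` splits
`T̄ = T̄⁺ ⊕ T̄⁻` into one-dimensional eigenspaces» (Compositio 140 (2004), §1.3; «made to overcome a technical
difficulty … the action on the residual representation does [extend]») is typed in the tree as the DATUM
`Howard2004.ResidualTau cd ρbar` (`θ`, involutive, `θ ∘ ρ̄(τ⁻¹ g τ) = ρ̄(g) ∘ θ`) plus the Prop `Howard2004.H5a A`.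

* **`WeierstrassCurve.residualTauGeomTorsion W cd hm hk`** — DEFINITION: for `E = W/ℚ`, a conjugation datum `cd` on
  the number field `K` and `m, k ≥ 1`, the datum `ResidualTau (R := A_{m,k}) cd (E_K[p])` whose `θ` is the action
  `τ_*` of `cd.τ` on `E_K[p]` (tree `IsLiftOfAut.torsionMap`), `A_{m,k}`-linear because `A_{m,k}` acts through `𝔽_p`;
  involutive since `τ` is; compatible by `IsLiftOfAut.torsionMap_smul`;
* `residualTauGeomTorsion_θ_apply` (unfolding);
* **`h5a_residualTauGeomTorsion_of_eigenvectors`** — H.5(a) from one non-zero `τ`-fixed and one non-zero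
  `τ`-anti-fixed point of `E_K[p]` (`p` odd), through x10b-p2's generic `Howard2004.h5a_of_ne_of_finrank_eq_two` at
  `k = 𝔽_p`, `dim E[p] = 2`;
* **`h5a_residualTauGeomTorsion_of_isComplexConjugation`** — H.5(a) OUTRIGHT when `cd.τ` is the transport
  `e c₀ e⁻¹` of a complex conjugation `c₀ ∈ Γ_ℚ` (`K` imaginary quadratic, `p` odd): the eigenvectors of `c₀` on
  `E(ℚ̄)[p]` (tree `RatClosure.exists_eigenvectors`, from the Weil pairing — `det ρ̄(c₀) = −1` — now unconditional,
  `exists_weilPairing_holds`) transported to `E(K̄)[p]` (`RatClosure.torsionEquiv_smul_of_lift`).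
No named fact, no instance, no `sorry`; BSD is not proved by any of this.

Cell `pub/bsd-print-x9`, seat `bsd-line-x9-p1-w2` (g5), v9-plan STUB 1a (datum `A` and field `h5a`) of the shared
μ-item on crux stmt-BirchSwinnertonDyer-27077.

References: [Howard2004HeegnerKolyvagin] §1.3 H.5 (arXiv p. 7, L93–97) and proof of Prop. 2.1.3; [McCallumLMS1991] §3
(both eigenspaces of complex conjugation on `E_p`); [GrossLMS1991] Prop. 9.5 (1).
-/

noncomputable section

open scoped TensorProduct

namespace WeierstrassCurve

open Literature.NumberTheory.EllipticCurves Literature.NumberTheory.GaloisRepresentations Field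
open Literature.NumberTheory.EllipticCurves.IwasawaAlgebra
open Literature.NumberTheory.GaloisCohomology

variable {K : Type} [Field K] [NumberField K] (W : WeierstrassCurve ℚ) {p : ℕ} [hp : Fact p.Prime]

/-- **The H.5(a) datum for `T̄_𝔮 = E_K[p]`**: `θ = τ_*`, the action of the involution `cd.τ` of `K̄` (lifting the
complex conjugation of `K`) on `E_K[p]`, as an `A_{m,k}`-linear involution intertwining `ρ̄ ∘ (τ⁻¹ · τ)` and `ρ̄` —
Howard's «the action of `G_K` on `T̄` extends to an action of `G_ℚ`» for `T̄ = E[p]`, `E` defined over `ℚ`.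
[cite: Howard2004HeegnerKolyvagin, §1.3 H.5(a) (arXiv p. 7, L93–95) and proof of Prop. 2.1.3] -/
def residualTauGeomTorsion (cd : Howard2004.ConjugationDatum K) {m k : ℕ} (hm : 1 ≤ m) (hk : 1 ≤ k) :
    letI := EisensteinCoeff.residueModule (p := p) (m := m) (k := k) hm hk
      ((W.baseChange K).prime_nsmul_geomTorsion_eq_zero (p := p))
    Howard2004.ResidualTau (R := EisensteinCoeff p m k) cd ((W.baseChange K).torsionGaloisModule (p : ℤ)) :=
  letI := EisensteinCoeff.residueModule (p := p) (m := m) (k := k) hm hk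
    ((W.baseChange K).prime_nsmul_geomTorsion_eq_zero (p := p))
  { θ :=
      { toFun := cd.isLift.torsionMap W (p : ℤ)
        map_add' := map_add _
        map_smul' := fun c P ↦ by
          rw [RingHom.id_apply, EisensteinCoeff.residueModule_smul p hm hk, map_nsmul,
            EisensteinCoeff.residueModule_smul p hm hk] }
    involutive := fun P ↦ by
      apply Subtype.ext
      change cd.isLift.pointsMap W (cd.isLift.pointsMap W (P : geomPoints (W.baseChange K))) = P
      generalize (P : geomPoints (W.baseChange K)) = Q
      change ((W.baseChange K).baseChange (AlgebraicClosure K)).toAffine.Point at Q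
      rcases Q with _ | ⟨x, y, h⟩
      · rfl
      · exact Affine.Point.some_eq_some_of_eq (cd.involutive x) (cd.involutive y)
    compat := fun g P ↦ by
      change cd.isLift.torsionMap W (p : ℤ) ((W.baseChange K).torsionGaloisModule (p : ℤ) (cd.conj g) P) =
        (W.baseChange K).torsionGaloisModule (p : ℤ) g (cd.isLift.torsionMap W (p : ℤ) P)
      rw [torsionGaloisModule_apply_apply, torsionGaloisModule_apply_apply]
      exact cd.isLift.torsionMap_smul W (p : ℤ) g P }

/-- Unfolding `residualTauGeomTorsion`: `θ P = τ_* P`. [cite: Howard2004HeegnerKolyvagin, §1.3 H.5(a)] -/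
theorem residualTauGeomTorsion_θ_apply (cd : Howard2004.ConjugationDatum K) {m k : ℕ} (hm : 1 ≤ m)
    (hk : 1 ≤ k) (P : geomTorsion (W.baseChange K) (p : ℤ)) :
    letI := EisensteinCoeff.residueModule (p := p) (m := m) (k := k) hm hk
      ((W.baseChange K).prime_nsmul_geomTorsion_eq_zero (p := p))
    (W.residualTauGeomTorsion (p := p) cd hm hk).θ P = cd.isLift.torsionMap W (p : ℤ) P :=
  rfl

omit [NumberField K] hp in
/-- On `E[p]` with `p` odd, `P = -P` forces `P = 0` (`2` and `p` are coprime; a private copy of the tree's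
`WeierstrassCurve.geomTorsion_eq_zero_of_eq_neg`). [cite: SilvermanAEC2009, III.§6 (E[m])] -/
private theorem geomTorsion_eq_zero_of_eq_neg_odd {F : Type} [Field F] (V : WeierstrassCurve F) (hp' : p.Prime)
    (hp2 : p ≠ 2) {P : geomTorsion V (p : ℤ)} (h : P = -P) : P = 0 := by
  have h2 : (2 : ℤ) • P = 0 := by rw [two_zsmul]; nth_rw 2 [h]; exact add_neg_cancel P
  have hpP : (p : ℤ) • P = 0 := by
    apply Subtype.ext
    rw [AddSubgroupClass.coe_zsmul, (mem_geomTorsion_iff V (p : ℤ) (P : geomPoints V)).mp P.2]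
    rfl
  obtain ⟨c, hc⟩ := hp'.odd_of_ne_two hp2
  have hsc : (p : ℤ) - c * 2 = 1 := by rw [hc]; push_cast; ring
  calc P = ((p : ℤ) - c * 2) • P := by rw [hsc, one_smul]
    _ = 0 := by rw [sub_smul, mul_smul, h2, smul_zero, sub_zero, hpP]

/-- **H.5(a) for `T̄_𝔮 = E_K[p]` from eigenvectors.** If `τ_*` has a non-zero fixed point and a non-zero anti-fixed
point on `E_K[p]` (`p` odd, `E` elliptic), then `Howard2004.H5a (residualTauGeomTorsion W cd hm hk)`: apply the generic
`Howard2004.h5a_of_ne_of_finrank_eq_two` with `k = 𝔽_p` (the residue character `A_{m,k} ↠ 𝔽_p`) and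
`dim_{𝔽_p} E[p] = 2` (`E[p] ≅ (ℤ/p)²`). [cite: Howard2004HeegnerKolyvagin, §1.3 H.5(a)] [cite: McCallumLMS1991, §3 (E_p^±)] -/
theorem h5a_residualTauGeomTorsion_of_eigenvectors [W.IsElliptic] (cd : Howard2004.ConjugationDatum K)
    {m k : ℕ} (hm : 1 ≤ m) (hk : 1 ≤ k) (hp2 : p ≠ 2)
    (hplus : ∃ P : geomTorsion (W.baseChange K) (p : ℤ), P ≠ 0 ∧ cd.isLift.torsionMap W (p : ℤ) P = P)
    (hminus : ∃ P : geomTorsion (W.baseChange K) (p : ℤ), P ≠ 0 ∧ cd.isLift.torsionMap W (p : ℤ) P = -P) :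
    letI := EisensteinCoeff.residueModule (p := p) (m := m) (k := k) hm hk
      ((W.baseChange K).prime_nsmul_geomTorsion_eq_zero (p := p))
    Howard2004.H5a (W.residualTauGeomTorsion (p := p) cd hm hk) := by
  haveI : Fact (1 < p) := ⟨hp.out.one_lt⟩
  have hN := (W.baseChange K).prime_nsmul_geomTorsion_eq_zero (p := p)
  letI : Module (ZMod p) (geomTorsion (W.baseChange K) (p : ℤ)) := AddCommGroup.zmodModule hN
  letI := EisensteinCoeff.residueModule (p := p) (m := m) (k := k) hm hk hN
  -- `dim_{𝔽_p} E[p] = 2`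
  have hpK : (p : K) ≠ 0 := by exact_mod_cast hp.out.ne_zero
  obtain ⟨e⟩ := (W.baseChange K).nonempty_geomTorsion_addEquiv_fin_two (m := p) hpK
  let eL : geomTorsion (W.baseChange K) (p : ℤ) ≃ₗ[ZMod p] (Fin 2 → ZMod p) :=
    LinearEquiv.ofBijective (e.toAddMonoidHom.toZModLinearMap p) ⟨e.injective, e.surjective⟩
  have hdim : Module.finrank (ZMod p) (geomTorsion (W.baseChange K) (p : ℤ)) = 2 := by
    rw [eL.finrank_eq, Module.finrank_fin_fun]
  have h2 : (2 : ZMod p) ≠ 0 := by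
    intro h
    have h' : ((2 : ℕ) : ZMod p) = 0 := by exact_mod_cast h
    rw [ZMod.natCast_eq_zero_iff] at h'
    exact hp2 ((Nat.prime_dvd_prime_iff_eq hp.out Nat.prime_two).mp h')
  -- `θ ≠ ±id`
  obtain ⟨Pp, hPp0, hPp⟩ := hplus
  obtain ⟨Pm, hPm0, hPm⟩ := hminus
  have hne : (W.residualTauGeomTorsion (p := p) cd hm hk).θ ≠ LinearMap.id := by
    intro h
    have h1 : cd.isLift.torsionMap W (p : ℤ) Pm = Pm := by
      rw [← residualTauGeomTorsion_θ_apply W cd hm hk, h]; rfl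
    exact hPm0 (geomTorsion_eq_zero_of_eq_neg_odd (W.baseChange K) hp.out hp2 (hPm.symm.trans h1).symm)
  have hne' : (W.residualTauGeomTorsion (p := p) cd hm hk).θ ≠ -LinearMap.id := by
    intro h
    have h1 : cd.isLift.torsionMap W (p : ℤ) Pp = -Pp := by
      rw [← residualTauGeomTorsion_θ_apply W cd hm hk, h]; rfl
    exact hPp0 (geomTorsion_eq_zero_of_eq_neg_odd (W.baseChange K) hp.out hp2 (hPp.symm.trans h1))
  exact Howard2004.h5a_of_ne_of_finrank_eq_two (EisensteinCoeff.residueChar p hm hk)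
    (EisensteinCoeff.residueChar_surjective p hm hk) (fun _ _ ↦ rfl) _ h2 hdim hne hne'

/-- **H.5(a) for `T̄_𝔮 = E_K[p]`, unconditionally, when `τ` is a complex conjugation.** Let `K` be imaginary quadratic,
`E/ℚ` elliptic, `p` odd, and let the conjugation datum's involution be the transport `e c₀ e⁻¹` to `K̄` of a complex
conjugation `c₀ ∈ Γ_ℚ`. Then `Howard2004.H5a (residualTauGeomTorsion W cd hm hk)` for all `m, k ≥ 1`: `c₀` has both
eigenvalues `±1` on `E(ℚ̄)[p]` (`det ρ̄(c₀) = −1` by the Weil pairing — tree `RatClosure.exists_eigenvectors`,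
`exists_weilPairing_holds`), transported to `E(K̄)[p]`. [cite: Howard2004HeegnerKolyvagin, §1.3 H.5(a) and proof of Prop. 2.1.3]
[cite: McCallumLMS1991, §3 (E_{p^M}^±)] [cite: GrossLMS1991, Prop. 9.5 (1)] -/
theorem h5a_residualTauGeomTorsion_of_isComplexConjugation [W.IsElliptic] (cd : Howard2004.ConjugationDatum K)
    {c₀ : absoluteGaloisGroup ℚ} (hc₀ : IsComplexConjugation (Rat.castHom ℝ) c₀)
    (hτ : ∀ x, cd.τ x = absGaloisTransport (K := ℚ) (L := K) c₀ x)
    {m k : ℕ} (hm : 1 ≤ m) (hk : 1 ≤ k) (hp2 : p ≠ 2) :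
    letI := EisensteinCoeff.residueModule (p := p) (m := m) (k := k) hm hk
      ((W.baseChange K).prime_nsmul_geomTorsion_eq_zero (p := p))
    Howard2004.H5a (W.residualTauGeomTorsion (p := p) cd hm hk) := by
  obtain ⟨⟨vp, hvp0, hvp⟩, ⟨vm, hvm0, hvm⟩⟩ :=
    RatClosure.exists_eigenvectors W hc₀ (W.exists_weilPairing_holds p) hp2
  let θK := RatClosure.torsionEquiv (K := K) W (p : ℤ)
  refine W.h5a_residualTauGeomTorsion_of_eigenvectors (p := p) cd hm hk hp2
    ⟨θK vp, fun h ↦ hvp0 (θK.injective (by rw [h, map_zero])), ?_⟩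
    ⟨θK vm, fun h ↦ hvm0 (θK.injective (by rw [h, map_zero])), ?_⟩
  · rw [← RatClosure.torsionEquiv_smul_of_lift W cd.isLift c₀ hτ (p : ℤ) vp, hvp]
  · rw [← RatClosure.torsionEquiv_smul_of_lift W cd.isLift c₀ hτ (p : ℤ) vm, hvm, map_neg]

end WeierstrassCurve

end
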